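import Summits.QuantumAdvantage.QuantumAdvantage.Theorems.AnchorDialCoreF

/-!
# AnchorDial — part 20 «Gauge» (cell decomp-qadv, seat lens-2, generation 15; supports item 26531 `ExactnessDial.PolyLossOddU3`)

§B–§C of the g15 node «GaugeDial».  §B: orbits under `F` far pair-flips in list form `orbL` and function form
`orbF b ε` (sites `b : Fin F → ℕ`, gaps `≥ 2`, `b_i + 3 ≤ N`), `oddZeros_orbF`, `zpar_orbF`, `orbF_apply_of_far`,
and the kernel shift law `cN_orbF_cast`: `c_k(x^ε) = c_k(x) + Σ_i ct(ε_i, u_i ⊕ [b_i+1 ≤ k])` in `𝔽₃`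
(`u_i = zpar x (b_i+1)` the hidden sign bits).  §C: GAUGE REDUCTION — the multi-window orbit law
`gauge_orbit_avoids`: a bet whose deviation set lies, at every orbit point, in `m` windows `[k_j, k_j+r]` each wholly
left or wholly right of the flip region, and which wins at all `2^F` orbit points, forces `AvoidsF a z 0` for the sign
vector `z` and a table `a = (ε ↦ thirdVal (dev P x^ε) (wG …))` that is a function of visible data and of the hidden
GAUGE `g = (c_{k_j}, u_j)_j ∈ (𝔽₃ × {0,1})^m` (`wG_eq_wTab`, `gaugeOf`, `gauge_orbit_law`); hence the `6^m` union
bound `card_gauge_compat_le : #{σ | ∃ g, AvoidsF (table g) σ 0} ≤ 6^m·(1+F+C(F,2))`.  Namespace `…Theorems.AnchorDial`;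
imports part 19.  Verbatim from the node file §B–§C; no `sorry`, no `native_decide`, no instances/notation.
-/

set_option linter.dupNamespace false
set_option linter.unusedVariables false

/-! ## §B  Orbits under `F` far pair-flips in ONE region (list form `orbL`, function form `orbF`) and the kernel
phases along them (`cN_orbL`, `cN_orbF_cast`: `c_k(x^ε) = c_k(x) + Σ_i [ε_i]·(1+[b_i+1 ≤ k])·σ_i`). -/

noncomputable section

open scoped Classical

namespace Summit.QuantumAdvantage.QuantumAdvantage.Theorems.AnchorDial

open Finset
open Literature.Computability.QuantumComplexity Literature.Computability.QuantumComplexity.RingHLF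
open Literature.Computability.MetaComplexity Literature.Computability.MetaComplexity.Smolensky
open Summit.QuantumAdvantage.AdviceFreeQNC0
open Summit.QuantumAdvantage.QuantumAdvantage.Theorems.HolonomyDial (gCond)

variable {N : ℕ}

section OrbitF

variable {F : ℕ}

/-- the orbit point of `x` under the optional adjacent pair-flips listed in `l` as (flag, site). -/
def orbL : List (Bool × ℕ) → (Fin N → Bool) → (Fin N → Bool)
  | [], x => x
  | p :: l, x => fz p.1 p.2 (orbL l x)

/-- AnchorDial GaugeDial helper `orbL_nil`. -/
theorem orbL_nil (x : Fin N → Bool) : orbL [] x = x := rfl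

/-- AnchorDial GaugeDial helper `orbL_cons`. -/
theorem orbL_cons (p : Bool × ℕ) (l : List (Bool × ℕ)) (x : Fin N → Bool) :
    orbL (p :: l) x = fz p.1 p.2 (orbL l x) := rfl

/-- AnchorDial GaugeDial helper `oddZeros_orbL`. -/
theorem oddZeros_orbL (l : List (Bool × ℕ)) (hl : ∀ p ∈ l, p.2 + 2 ≤ N) (x : Fin N → Bool) :
    OddZeros (orbL l x) ↔ OddZeros x := by
  induction l with
  | nil => rfl
  | cons p l ih =>
    rw [orbL_cons, oddZeros_fz p.1 (hl p (by simp)), ih (fun q hq => hl q (by simp [hq]))]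

/-- AnchorDial GaugeDial helper `zpar_orbL`: prefix parities off the parity sites `a + 1` are orbit-invariant. -/
theorem zpar_orbL (l : List (Bool × ℕ)) (hl : ∀ p ∈ l, p.2 + 2 ≤ N) (x : Fin N → Bool) (k : ℕ) (hk : k ≤ N)
    (hne : ∀ p ∈ l, k ≠ p.2 + 1) : zpar (orbL l x) k = zpar x k := by
  induction l with
  | nil => rfl
  | cons p l ih =>
    rw [orbL_cons, zpar_fz p.1 (hl p (by simp)) _ k hk (hne p (by simp)),
      ih (fun q hq => hl q (by simp [hq])) (fun q hq => hne q (by simp [hq]))]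

/-- AnchorDial GaugeDial helper `orbL_apply_of_far`: bits off the flip positions are orbit-invariant. -/
theorem orbL_apply_of_far (l : List (Bool × ℕ)) (x : Fin N → Bool) (j : Fin N)
    (hj : ∀ p ∈ l, j.val ≠ p.2 ∧ j.val ≠ p.2 + 1) : orbL l x j = x j := by
  induction l with
  | nil => rfl
  | cons p l ih =>
    rw [orbL_cons, fz_apply]
    have h := hj p (by simp)
    rw [if_neg (by
      rintro ⟨-, h' | h'⟩
      · exact h.1 h'
      · exact h.2 h'), ih (fun q hq => hj q (by simp [hq]))]

/-- **kernel phases along a list orbit** (sites pairwise distinct, each `a + 3 ≤ N`):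
`c_k(orbL l x) ≡ c_k(x) + Σ_{(e,a) ∈ l} sh e [a+1 ≤ k] (zpar x (a+1))  (mod 3)`. -/
theorem cN_orbL (x : Fin N → Bool) (k : ℕ) (hk : k ≤ N) : ∀ l : List (Bool × ℕ), (∀ p ∈ l, p.2 + 3 ≤ N) →
    l.Pairwise (fun p q => p.2 ≠ q.2) →
    cN (orbL l x) k % 3 =
      (cN x k + (l.map fun p => sh p.1 (decide (p.2 + 1 ≤ k)) (zpar x (p.2 + 1))).sum) % 3 := by
  intro l
  induction l with
  | nil => intro _ _; simp [orbL]
  | cons p l ih =>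
    intro hl hpw
    rw [List.pairwise_cons] at hpw
    have IH := ih (fun q hq => hl q (by simp [hq])) hpw.2
    rw [orbL_cons, cN_fz (orbL l x) (hl p (by simp)) k hk p.1,
      zpar_orbL l (fun q hq => by have := hl q (by simp [hq]); omega) x (p.2 + 1)
        (by have := hl p (by simp); omega) (fun q hq => by have := hpw.1 q hq; omega),
      List.map_cons, List.sum_cons]
    omega

/-- the `2^F`-point ORBIT of `x` under the far pair-flips at the sites `b_0 < b_1 < … < b_{F-1}` (one region). -/
def orbF (b : Fin F → ℕ) (ε : Fin F → Bool) (x : Fin N → Bool) : Fin N → Bool :=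
  orbL (List.ofFn fun i => (ε i, b i)) x

/-- AnchorDial GaugeDial helper `orbF_sites2`. -/
theorem orbF_sites2 {b : Fin F → ℕ} (hbN : ∀ i, b i + 3 ≤ N) (ε : Fin F → Bool) :
    ∀ p ∈ List.ofFn (fun i => (ε i, b i)), p.2 + 2 ≤ N :=
  List.forall_mem_ofFn_iff.2 fun i => by have := hbN i; simp only; omega

/-- AnchorDial GaugeDial helper `oddZeros_orbF`. -/
theorem oddZeros_orbF {b : Fin F → ℕ} (hbN : ∀ i, b i + 3 ≤ N) (ε : Fin F → Bool) (x : Fin N → Bool) :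
    OddZeros (orbF b ε x) ↔ OddZeros x :=
  oddZeros_orbL _ (orbF_sites2 hbN ε) x

/-- AnchorDial GaugeDial helper `zpar_orbF`. -/
theorem zpar_orbF {b : Fin F → ℕ} (hbN : ∀ i, b i + 3 ≤ N) (ε : Fin F → Bool) (x : Fin N → Bool) (k : ℕ)
    (hk : k ≤ N) (hne : ∀ i, k ≠ b i + 1) : zpar (orbF b ε x) k = zpar x k :=
  zpar_orbL _ (orbF_sites2 hbN ε) x k hk (List.forall_mem_ofFn_iff.2 fun i => hne i)

/-- AnchorDial GaugeDial helper `orbF_apply_of_far`. -/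
theorem orbF_apply_of_far (b : Fin F → ℕ) (ε : Fin F → Bool) (x : Fin N → Bool) (j : Fin N)
    (hj : ∀ i, j.val ≠ b i ∧ j.val ≠ b i + 1) : orbF b ε x j = x j :=
  orbL_apply_of_far _ x j (List.forall_mem_ofFn_iff.2 fun i => hj i)

/-- **kernel phases along the F-orbit, in `𝔽₃`**: `c_k(x^ε) = c_k(x) + Σ_i ct(ε_i)(zpar x (b_i+1) ⊕ [b_i+1 ≤ k])`. -/
theorem cN_orbF_cast (x : Fin N → Bool) {b : Fin F → ℕ} (hb : ∀ i j : Fin F, i < j → b i + 2 ≤ b j)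
    (hbN : ∀ i, b i + 3 ≤ N) (ε : Fin F → Bool) (k : ℕ) (hk : k ≤ N) :
    ((cN (orbF b ε x) k : ℕ) : ZMod 3) =
      ((cN x k : ℕ) : ZMod 3) + ∑ i, Core.ct (ε i) (xor (zpar x (b i + 1)) (decide (b i + 1 ≤ k))) := by
  have hl : ∀ p ∈ List.ofFn (fun i => (ε i, b i)), p.2 + 3 ≤ N := List.forall_mem_ofFn_iff.2 fun i => hbN i
  have hpw : (List.ofFn fun i => (ε i, b i)).Pairwise (fun p q => p.2 ≠ q.2) :=
    List.pairwise_ofFn.2 fun i j hij => by have := hb i j hij; simp only; omega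
  have h := cN_orbL x k hk _ hl hpw
  have h' := congrArg (fun v : ℕ => ((v : ℕ) : ZMod 3)) h
  simp only [ZMod.natCast_mod] at h'
  unfold orbF
  rw [h', List.map_ofFn, List.sum_ofFn]
  push_cast [sh_cast, Function.comp_apply]
  rfl

end OrbitF

/-! ## §C  GAUGE REDUCTION: the multi-window orbit law.  A bet whose deviation set lies in `m` windows
`[k_j, k_j + r]` off the flip region wins at all `2^F` orbit points only if, for the TRUE hidden gauge
`(c_{k_j}(x), zpar x (k_j+1))_j ∈ (𝔽₃ × {0,1})^m`, the visible excluded-value table AVOIDS the orbit line of the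
sign vector `(zpar x (b_i+1))_i` through `τ = 0` (`gauge_orbit_avoids`); so the sign vector lies in a set of
`≤ 6^m·(1 + F + C(F,2))` of the `2^F` patterns determined by VISIBLE data alone (`card_gauge_compat_le`). -/

section GaugeOrbit

variable {F m : ℕ}

/-- AnchorDial GaugeDial helper: `ct e (z ⊕ u) = sg u · ct e z` (the window's SIDE rescales the line). -/
theorem ct_xor_side : ∀ e z u : Bool, Core.ct e (xor z u) = Core.sg u * Core.ct e z := by decide

/-- AnchorDial GaugeDial helper: solving the window inequality for the orbit variable (`sg u` is a unit). -/
theorem gauge_solve : ∀ (u : Bool) (c s a : ZMod 3), (c + Core.sg u * s ≠ a ↔ s ≠ Core.sg u * (a - c)) := by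
  decide

/-- the per-position AVOIDED-VALUE MAP of a multi-window bet in the orbit gauge: position `q`, described from
anchor `j = J q` at offset `t = q - k_j`, window side `u_j`, contributes `sg(u_j)·(α_{j,t}(x) - c_{k_j}(x))` where
`α_{j,t}` is the window value (reflected under odd entrance parity). -/
def wG (x : Fin N → Bool) (kA : Fin m → ℕ) (sd : Fin m → Bool) (J : Fin N → Fin m) (q : Fin N) : ZMod 3 :=
  Core.sg (sd (J q)) *
    ((if zpar x (kA (J q) + 1) = true then 1 - wval x (kA (J q)) (q.val - kA (J q))
      else wval x (kA (J q)) (q.val - kA (J q))) - ((cN x (kA (J q)) : ℕ) : ZMod 3))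

/-- **THE MULTI-WINDOW ORBIT LAW (gauge form)**.  Sites `b_0 < … < b_{F-1}` (gaps `≥ 2`, `b_i + 3 ≤ N`), anchors
`k_j` each with its whole window `[k_j, k_j + r]` LEFT of all sites (`sd j = 0`) or RIGHT of all parity sites
(`sd j = 1`), an assignment `J` of positions to anchors valid for every deviation point along the orbit, and WIN at
all `2^F` orbit points ⟹ the table `ε ↦ thirdVal (dev P x^ε) (wG x)` avoids the line of the sign vector
`(zpar x (b_i+1))_i` through `0`. -/
theorem gauge_orbit_avoids (hN : 3 ≤ N) (P : Fin N → CubeFn (ZMod 3) N) (x : Fin N → Bool) (hx : OddZeros x)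
    {b : Fin F → ℕ} (hb : ∀ i j : Fin F, i < j → b i + 2 ≤ b j) (hbN : ∀ i, b i + 3 ≤ N)
    (kA : Fin m → ℕ) (sd : Fin m → Bool) (r : ℕ)
    (hside : ∀ j, (sd j = false → ∀ i, kA j + r < b i) ∧ (sd j = true → ∀ i, b i + 1 ≤ kA j))
    (J : Fin N → Fin m)
    (hdev : ∀ ε, ∀ q ∈ dev P (orbF b ε x), kA (J q) ≤ q.val ∧ q.val ≤ kA (J q) + r)
    (hwin : ∀ ε, Rel (orbF b ε x) (outB P (orbF b ε x))) :
    CoreF.AvoidsF (fun ε => thirdVal (dev P (orbF b ε x)) (wG x kA sd J)) (fun i => zpar x (b i + 1)) 0 := by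
  intro ε
  set y := orbF b ε x with hy
  have hyodd : OddZeros y := (oddZeros_orbF hbN ε x).2 hx
  have hrel := hwin ε
  rw [win_iff hN P y hyodd] at hrel
  set s : ZMod 3 := ∑ i, Core.ct (ε i) (zpar x (b i + 1)) with hs
  have e : ((dev P y).filter fun q => gCond y q.val) = (dev P y).filter fun q => s ≠ wG x kA sd J q := by
    refine filter_congr fun q hq => ?_
    obtain ⟨hkq, hqk⟩ := hdev ε q hq
    have hqN := q.isLt
    have hkb : ∀ i, kA (J q) ≠ b i ∧ decide (b i + 1 ≤ kA (J q)) = sd (J q) := by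
      intro i
      obtain ⟨hl, hr⟩ := hside (J q)
      cases hsd : sd (J q)
      · have := hl hsd i
        exact ⟨by omega, by simp only [decide_eq_false_iff_not]; omega⟩
      · have := hr hsd i
        exact ⟨by omega, by simp only [decide_eq_true_eq]; omega⟩
    have hjt : kA (J q) + (q.val - kA (J q)) = q.val := by omega
    have hg := gCond_window y (kA (J q)) (q.val - kA (J q)) (by rw [hjt]; exact hqN)
    rw [hjt] at hg
    rw [hg]
    have hz : zpar y (kA (J q) + 1) = zpar x (kA (J q) + 1) :=
      zpar_orbF hbN ε x (kA (J q) + 1) (by omega) (fun i => by have := (hkb i).1; omega)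
    have hw : wval y (kA (J q)) (q.val - kA (J q)) = wval x (kA (J q)) (q.val - kA (J q)) := by
      unfold wval
      rw [wcnt_local (kA (J q)) (q.val - kA (J q)) (by omega) y x (fun q' h1 h2 =>
        orbF_apply_of_far b ε x q' (fun i => ?_))]
      obtain ⟨hl, hr⟩ := hside (J q)
      cases hsd : sd (J q)
      · have := hl hsd i; omega
      · have := hr hsd i; omega
    have hc : ((cN y (kA (J q)) : ℕ) : ZMod 3) = ((cN x (kA (J q)) : ℕ) : ZMod 3) + Core.sg (sd (J q)) * s := by
      rw [hy, cN_orbF_cast x hb hbN ε (kA (J q)) (by omega), hs, mul_sum]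
      congr 1
      exact sum_congr rfl fun i _ => by rw [(hkb i).2, ct_xor_side]
    rw [hz, hw, hc, gauge_solve]
    exact Iff.rfl
  rw [e] at hrel
  have h := ne_third_false (dev P y) (wG x kA sd J) s hrel
  have hl : CoreF.lvF (fun i => zpar x (b i + 1)) 0 ε = s := by
    unfold CoreF.lvF; rw [zero_add]
  show thirdVal (dev P y) (wG x kA sd J) ≠ CoreF.lvF (fun i => zpar x (b i + 1)) 0 ε
  rw [hl]
  exact h.symm

/-- the hidden GAUGE of `x` at the anchors: kernel phase and entrance parity per anchor (`6^m` values). -/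
def gaugeOf (x : Fin N → Bool) (kA : Fin m → ℕ) : Fin m → ZMod 3 × Bool :=
  fun j => (((cN x (kA j) : ℕ) : ZMod 3), zpar x (kA j + 1))

/-- the avoided-value map as a function of the VISIBLE window values `wv j t` (`= wval x (k_j) t`, local window
bits) and of a gauge `g ∈ (𝔽₃ × {0,1})^m`. -/
def wTab (kA : Fin m → ℕ) (sd : Fin m → Bool) (J : Fin N → Fin m) (wv : Fin m → ℕ → ZMod 3)
    (g : Fin m → ZMod 3 × Bool) (q : Fin N) : ZMod 3 :=
  Core.sg (sd (J q)) *
    ((if (g (J q)).2 = true then 1 - wv (J q) (q.val - kA (J q)) else wv (J q) (q.val - kA (J q))) - (g (J q)).1)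

/-- AnchorDial GaugeDial helper `wG_eq_wTab`: the true map is the visible map at the true gauge. -/
theorem wG_eq_wTab (x : Fin N → Bool) (kA : Fin m → ℕ) (sd : Fin m → Bool) (J : Fin N → Fin m) :
    wG x kA sd J = wTab kA sd J (fun j t => wval x (kA j) t) (gaugeOf x kA) := rfl

/-- **GAUGE REDUCTION (class form)**: under the hypotheses of `gauge_orbit_avoids`, the sign vector of `x` lies in
the set of sign vectors compatible with SOME gauge — a set determined by the visible data (deviation patterns
along the orbit, window values, anchors, sides). -/
theorem gauge_orbit_law (hN : 3 ≤ N) (P : Fin N → CubeFn (ZMod 3) N) (x : Fin N → Bool) (hx : OddZeros x)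
    {b : Fin F → ℕ} (hb : ∀ i j : Fin F, i < j → b i + 2 ≤ b j) (hbN : ∀ i, b i + 3 ≤ N)
    (kA : Fin m → ℕ) (sd : Fin m → Bool) (r : ℕ)
    (hside : ∀ j, (sd j = false → ∀ i, kA j + r < b i) ∧ (sd j = true → ∀ i, b i + 1 ≤ kA j))
    (J : Fin N → Fin m)
    (hdev : ∀ ε, ∀ q ∈ dev P (orbF b ε x), kA (J q) ≤ q.val ∧ q.val ≤ kA (J q) + r)
    (hwin : ∀ ε, Rel (orbF b ε x) (outB P (orbF b ε x))) :
    (fun i => zpar x (b i + 1)) ∈ univ.filter fun σ : Fin F → Bool => ∃ g : Fin m → ZMod 3 × Bool,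
      CoreF.AvoidsF (fun ε => thirdVal (dev P (orbF b ε x)) (wTab kA sd J (fun j t => wval x (kA j) t) g)) σ 0 :=
  mem_filter.2 ⟨mem_univ _, gaugeOf x kA, by
    rw [← wG_eq_wTab]; exact gauge_orbit_avoids hN P x hx hb hbN kA sd r hside J hdev hwin⟩

/-- **CORE_m(F) ≤ 6^m·(1 + F + C(F,2))**: for FIXED visible data — deviation patterns `S ε` along the orbit, window
values `wv`, anchors, sides, assignment — at most `6^m·(1+F+C(F,2))` of the `2^F` sign vectors are compatible with
winning at all orbit points under some hidden gauge (`< 2^F` once `F ≥ 12` for `m = 2`, `two_anchor_numerics`). -/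
theorem card_gauge_compat_le (hF : 4 ≤ F) (S : (Fin F → Bool) → Finset (Fin N)) (kA : Fin m → ℕ)
    (sd : Fin m → Bool) (J : Fin N → Fin m) (wv : Fin m → ℕ → ZMod 3) :
    (univ.filter fun σ : Fin F → Bool => ∃ g : Fin m → ZMod 3 × Bool,
      CoreF.AvoidsF (fun ε => thirdVal (S ε) (wTab kA sd J wv g)) σ 0).card ≤ 6 ^ m * (1 + F + F.choose 2) := by
  have h := CoreF.card_exists_avoidsF_le hF
    (fun g : Fin m → ZMod 3 × Bool => fun ε => thirdVal (S ε) (wTab kA sd J wv g))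
  rw [Fintype.card_fun, Fintype.card_prod, ZMod.card, Fintype.card_bool, Fintype.card_fin] at h
  exact h

end GaugeOrbit

end Summit.QuantumAdvantage.QuantumAdvantage.Theorems.AnchorDial

end
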